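import Literature.AlgebraicGeometry.AbelianSchemes.AbelianSchemeRelDimOfGenericFibre
import Literature.AlgebraicGeometry.AbelianSchemes.AbelianSchemeBaseChangeViaIso
import Literature.AlgebraicGeometry.AbelianSchemes.PolarizedAbelianSchemeWithLevel
import Literature.RingTheory.Artinian.SmallExtensionFlag
import HarnessLib

/-!
# An abelian scheme lifts along `A → A⧸J₀` over an Artin local ring by DESCENT ALONG PRINCIPAL SMALL RUNGS, given the one-rung lifts
# ([Oort1971] §2.2, first proof of Thm. (2.2.1), pp. 279–280: «by induction on the length … we may assume `𝔪·I = 0` and `I ≅ k`»;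
# [MumfordFogartyKirwan1994] Ch. 6 §3 Prop. 6.15; [StacksProject, Tag 06GE])

Layer `Literature/AlgebraicGeometry/AbelianSchemes`, namespace `Literature.AlgebraicGeometry.AbelianSchemes.AbelianSchemeOver`.
PROOF FILE, THEOREMS ONLY (no definition, no instance, no notation, no named fact, no `sorry`).  FINAL-CONSUMER head **FC-3** of the (U) road
(cell `hodgecm-mathlib`, P6 sub-desk P6b, desk re-deal 2026-09-02T19:58:46Z, re-cut 20:08:04Z; count-neutral ★ capital on
`--supports stmt-HodgeConjecture-24832`): the SCHEME-SIDE DESCENT.  The ring side is ★ `RingTheory/Artinian/SmallExtensionFlag` (B-p04 (g50)):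
`descent_on_principalSmall` — for `A` Artin local, a motive true at `J₀` and transferred down every PRINCIPAL SMALL RUNG `J′ < J ≤ J₀`
(`𝔪·J ≤ J′`, `J = J′ + (t)`, `t ∉ J′`) holds at `⊥`.  The ONE-RUNG lift of abelian schemes is taken as a BINDER `hstep` in the letters of
FC-2 §2 `exists_abelianLift_of_classZero` (A-p12 (g31)) read along `Spec (A⧸J → A⧸J′)`; the FC-4 assembler feeds it from the named hypothesis
`LiftObstructionVanishes` through FC-2 §2 and the iterated-quotient transport `(A⧸J′)⧸(J∕J′) ≅ A⧸J`.  THIS FILE composes the rungs.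

THE PRINT.  [Oort1971, p. 279]: «Let `R → R′` be a surjection of local artinian rings with kernel `I`; by induction on the length of `I` we may
assume `𝔪_R · I = 0` …»; [MumfordFogartyKirwan1994, Prop. 6.15, proof p. 125]: «by induction we may assume `𝔪·I = (0)`»;
[StacksProject, Tag 06GE]: every surjection of Artinian local rings factors into small principal extensions.

* §1 `factor_self`, `factor_comp_factor` — the quotient maps `A⧸J′ → A⧸J → A⧸J₀` compose (the only ring identities of the descent);
  `isBaseChangeVia_factor_self` — the motive at the top (`X₀` is its own base change along `Spec (A⧸J₀ → A⧸J₀)`).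
* §2 **`exists_abelianLift_of_rungs`** — THE DESCENT: `A` Artin local, `J₀` ANY ideal, `hstep` = along every principal small rung `J′ < J ≤ J₀`
  every abelian scheme of relative dimension `g` over `Spec (A⧸J)` is the base change (as a GROUP scheme, ★ `IsBaseChangeVia`) of one over
  `Spec (A⧸J′)` along `Spec (A⧸J′ → A⧸J)` ⟹ every abelian scheme `X₀` of relative dimension `g` over `Spec (A⧸J₀)` is the base change of an
  abelian scheme `X` of relative dimension `g` over `Spec A` along `Spec (A → A⧸J₀)` — the conclusion of the banked
  `stub_L4B1u_abelianLiftOfIsUnitTwo` token for token (motive `Q J := ∀ h : J ≤ J₀, ∃ Y (_ : Y.IsOfRelDim g) G, X₀.IsBaseChangeVia Y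
  (Spec (factor h)) G`; ★ `descent_on_principalSmall`; the rung = `hstep` + ★ `IsBaseChangeVia.trans`; the bottom `A ≅ A⧸⊥` = ★
  `isBaseChangeVia_baseChange_inv` (LA2-p03 (g5)) + ★ `IsOfRelDim.of_isBaseChangeVia`).  Degenerate reach: `J₀ = ⊥` and `J₀ = ⊤`
  (then `Spec (A⧸⊤) = ∅` and `hstep`'s rungs still start at proper `J ≤ ⊤`… — no: rungs need `𝔪·J ≤ J′`; the driver handles it).

HC_CM is proved only modulo the printed citations until rung 0 closes; nothing here bears on a summit statement.

## References
* [Oort1971] F. Oort, *Finite group schemes, local moduli for abelian varieties, and lifting problems*, Compositio Math. 23 (1971),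
  Theorem (2.2.1) (p. 273) and its first proof (pp. 279–280).
* [MumfordFogartyKirwan1994] D. Mumford, J. Fogarty, F. Kirwan, *Geometric Invariant Theory*, 3rd ed. (1994), Ch. 6 §3 Prop. 6.15
  (p. 124) and its proof (p. 125); Ch. 7 §2 Def. 7.2 (p. 129) (base change of abelian schemes).
* [StacksProject] The Stacks Project, Tag 06GE (small extensions of Artinian local rings).
-/

noncomputable section

set_option backward.isDefEq.respectTransparency false

open CategoryTheory CategoryTheory.Limits AlgebraicGeometry

universe u

namespace Literature.AlgebraicGeometry.AbelianSchemes.AbelianSchemeOver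

open Literature.RingTheory.Artinian

/-! ## §1 The quotient maps of the descent compose; the motive at the top -/

/-- `A⧸I → A⧸I` along `le_rfl` is the identity. [cite: MumfordFogartyKirwan1994, Ch. 6 §3 Proposition 6.15 (p. 124), proof (p. 125)] -/
theorem factor_self {A : Type u} [CommRing A] (I : Ideal A) : Ideal.Quotient.factor (le_refl I) = RingHom.id (A ⧸ I) :=
  Ideal.Quotient.ringHom_ext (by rw [Ideal.Quotient.factor_comp_mk, RingHom.id_comp])

/-- `A⧸I → A⧸J → A⧸K` is `A⧸I → A⧸K` (`I ≤ J ≤ K`). [cite: Oort1971, Theorem (2.2.1) first proof (pp. 279–280)] -/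
theorem factor_comp_factor {A : Type u} [CommRing A] {I J K : Ideal A} (hIJ : I ≤ J) (hJK : J ≤ K) :
    (Ideal.Quotient.factor hJK).comp (Ideal.Quotient.factor hIJ) = Ideal.Quotient.factor (hIJ.trans hJK) :=
  Ideal.Quotient.ringHom_ext (by rw [RingHom.comp_assoc, Ideal.Quotient.factor_comp_mk, Ideal.Quotient.factor_comp_mk,
    Ideal.Quotient.factor_comp_mk])

/-- **The motive at the top:** `X₀` is its own base change (as a group scheme) along `Spec (A⧸J₀ → A⧸J₀)` = `Spec (factor le_rfl)`.
[cite: MumfordFogartyKirwan1994, Ch. 7 §2 Definition 7.2 (p. 129)] -/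
theorem isBaseChangeVia_factor_self {A : Type u} [CommRing A] {J₀ : Ideal A} (X₀ : AbelianSchemeOver (Spec (.of (A ⧸ J₀)))) (h : J₀ ≤ J₀) :
    X₀.IsBaseChangeVia X₀ (Spec.map (CommRingCat.ofHom (Ideal.Quotient.factor h))) (𝟙 _) := by
  rw [show Ideal.Quotient.factor h = RingHom.id _ from factor_self J₀, CommRingCat.ofHom_id, Spec.map_id]
  exact IsBaseChangeVia.refl X₀

/-! ## §2 The descent along principal small rungs -/

/-- **FC-3 — LIFTING AN ABELIAN SCHEME ALONG `A → A⧸J₀` BY DESCENT ON PRINCIPAL SMALL RUNGS.**  Let `A` be an Artin local ring and `J₀` an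
ideal; suppose that along every principal small rung `J′ < J ≤ J₀` (`maximalIdeal A · J ≤ J′`, `J = J′ + (t)`, `t ∈ J`, `t ∉ J′`) every abelian
scheme `Y₀` of relative dimension `g` over `Spec (A⧸J)` is the base change, as a GROUP scheme, of an abelian scheme `Y` of relative dimension
`g` over `Spec (A⧸J′)` along `Spec (A⧸J′ → A⧸J)` (`hstep`: FC-2 §2 read through `(A⧸J′)⧸(J∕J′) ≅ A⧸J` — there the rung is a principal small
extension with residue-line kernel and the lift exists when the obstruction class vanishes).  THEN every abelian scheme `X₀` of relative dimension
`g` over `Spec (A⧸J₀)` is the base change, as a group scheme, of an abelian scheme `X` of relative dimension `g` over `Spec A` along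
`Spec (A → A⧸J₀)`.  Proof: ★ `descent_on_principalSmall` on the motive «`X₀` lifts to `Spec (A⧸J)` compatibly with `Spec (A⧸J → A⧸J₀)`»
(top: §1; rung: `hstep` + ★ `IsBaseChangeVia.trans` + §1 `factor_comp_factor`), then ONE transport along `Spec (A⧸⊥) ≅ Spec A`
(★ `isBaseChangeVia_baseChange_inv`, ★ `IsOfRelDim.of_isBaseChangeVia`). [cite: Oort1971, Theorem (2.2.1) (p. 273), first proof (pp. 279–280)]
[cite: MumfordFogartyKirwan1994, Ch. 6 §3 Proposition 6.15 (p. 124), proof (p. 125)] [cite: StacksProject, Tag 06GE] -/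
theorem exists_abelianLift_of_rungs {A : Type u} [CommRing A] [IsArtinianRing A] [IsLocalRing A] (J₀ : Ideal A) {g : ℕ}
    (hstep : ∀ ⦃J J' : Ideal A⦄ (t : A) (_ : J ≤ J₀) (hJ'J : J' < J) (_ : IsLocalRing.maximalIdeal A * J ≤ J') (_ : t ∈ J) (_ : t ∉ J')
      (_ : J' ⊔ Ideal.span {t} = J) (Y₀ : AbelianSchemeOver (Spec (.of (A ⧸ J)))), Y₀.IsOfRelDim g →
        ∃ (Y : AbelianSchemeOver (Spec (.of (A ⧸ J')))) (_ : Y.IsOfRelDim g) (G : Y₀.X.left ⟶ Y.X.left),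
          Y₀.IsBaseChangeVia Y (Spec.map (CommRingCat.ofHom (Ideal.Quotient.factor hJ'J.le))) G)
    (X₀ : AbelianSchemeOver (Spec (.of (A ⧸ J₀)))) (hg : X₀.IsOfRelDim g) :
    ∃ (X : AbelianSchemeOver (Spec (.of A))) (_ : X.IsOfRelDim g) (G : X₀.X.left ⟶ X.X.left),
      X₀.IsBaseChangeVia X (Spec.map (CommRingCat.ofHom (Ideal.Quotient.mk J₀))) G := by
  -- THE DESCENT on the motive «`X₀` lifts to `Spec (A ⧸ J)` compatibly with `Spec (A ⧸ J → A ⧸ J₀)`»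
  have hbot : ∀ h : (⊥ : Ideal A) ≤ J₀, ∃ (Y : AbelianSchemeOver (Spec (.of (A ⧸ (⊥ : Ideal A))))) (_ : Y.IsOfRelDim g)
      (G : X₀.X.left ⟶ Y.X.left), X₀.IsBaseChangeVia Y (Spec.map (CommRingCat.ofHom (Ideal.Quotient.factor h))) G := by
    refine descent_on_principalSmall J₀
      (Q := fun J => ∀ h : J ≤ J₀, ∃ (Y : AbelianSchemeOver (Spec (.of (A ⧸ J)))) (_ : Y.IsOfRelDim g) (G : X₀.X.left ⟶ Y.X.left),
        X₀.IsBaseChangeVia Y (Spec.map (CommRingCat.ofHom (Ideal.Quotient.factor h))) G)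
      (fun h => ⟨X₀, hg, 𝟙 _, isBaseChangeVia_factor_self X₀ h⟩) ?_
    intro J J' t hJJ₀ hJ'J hmJ htJ htJ' hsup hQ hJ'J₀
    obtain ⟨Y₁, hY₁, G₁, h₁⟩ := hQ hJJ₀
    obtain ⟨Y, hY, G₂, h₂⟩ := hstep t hJJ₀ hJ'J hmJ htJ htJ' hsup Y₁ hY₁
    refine ⟨Y, hY, G₁ ≫ G₂, ?_⟩
    have h := h₁.trans h₂
    rwa [← Spec.map_comp, ← CommRingCat.ofHom_comp, factor_comp_factor hJ'J.le hJJ₀] at h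
  -- THE BOTTOM: transport along `Spec (A ⧸ ⊥) ≅ Spec A` (★ `isBaseChangeVia_baseChange_inv`)
  obtain ⟨Y, hY, G, h⟩ := hbot bot_le
  have hbij : Function.Bijective (Ideal.Quotient.mk (⊥ : Ideal A)) := by
    refine ⟨fun x y hxy => ?_, Ideal.Quotient.mk_surjective⟩
    rw [Ideal.Quotient.eq, Ideal.mem_bot, sub_eq_zero] at hxy
    exact hxy
  haveI : IsIso (Spec.map (CommRingCat.ofHom (Ideal.Quotient.mk (⊥ : Ideal A)))) := by
    haveI : IsIso (CommRingCat.ofHom (Ideal.Quotient.mk (⊥ : Ideal A))) := by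
      rw [show CommRingCat.ofHom (Ideal.Quotient.mk (⊥ : Ideal A)) = (RingEquiv.ofBijective _ hbij).toCommRingCatIso.hom from rfl]
      infer_instance
    infer_instance
  let e : Spec (.of A) ≅ Spec (.of (A ⧸ (⊥ : Ideal A))) := (asIso (Spec.map (CommRingCat.ofHom (Ideal.Quotient.mk (⊥ : Ideal A))))).symm
  have hX := isBaseChangeVia_baseChange_inv Y e
  have hfin := h.trans hX
  rw [show Spec.map (CommRingCat.ofHom (Ideal.Quotient.factor (bot_le : (⊥ : Ideal A) ≤ J₀))) ≫ e.inv =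
      Spec.map (CommRingCat.ofHom (Ideal.Quotient.mk J₀)) by
    rw [Iso.symm_inv, asIso_hom, ← Spec.map_comp, ← CommRingCat.ofHom_comp, Ideal.Quotient.factor_comp_mk]] at hfin
  exact ⟨Y.baseChange e.hom, IsOfRelDim.of_isBaseChangeVia (Y.baseChange_isBaseChangeVia e.hom) hY, _, hfin⟩

end Literature.AlgebraicGeometry.AbelianSchemes.AbelianSchemeOver

end
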